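import Summits.QuantumFields.QCD.Theses.SpectralDefectExtinction
import Literature.MathematicalPhysics.QuantumFieldTheory.QCDPhaseQuenched
import Literature.MathematicalPhysics.QuantumFieldTheory.SpectralDefectDensity
import Literature.Barriers.QuantumFields.WilsonDeterminantMassSplitting
import Summits.QuantumFields.QCD.Theorems.SpectralDefectExtinctionWegnerEstimateStubCountLeResolvent
import Summits.QuantumFields.QCD.Theorems.SpectralDefectExtinctionWegnerEstimateStubLocalTraceRegular
import Summits.QuantumFields.QCD.Theorems.SpectralDefectExtinctionWegnerEstimateStubGlueHaar
import Summits.QuantumFields.QCD.Theorems.SpectralDefectExtinctionWegnerEstimateStubUntilt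
import Summits.QuantumFields.QCD.Theorems.SpectralDefectExtinctionWegnerEstimateStubCellAverageBound

/-!
# The resolvent–cell REDUCTION of crux `SpectralDefectExtinction.WegnerEstimate` (item stmt-QuantumFields-8966)

Line `Sketch` (skeleton "ResolventCell", `Cruxes/WegnerEstimate/Lines/Sketch.lean`), lead
prover-line-stmt-QuantumFields-8966-0.  This file lands the COMPOSITION of the line as a conditional theorem:
the crux `WegnerEstimate` follows from the one open stub `stub_localHaarWegner` — a β-free, `L`-free local Wegner
estimate for Haar-link disorder with frozen exterior — using the five landed stubs `stub_countLeResolvent`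
(p87058), `stub_localTraceRegular` (p88424), `stub_glueHaar` (p89804), `stub_untilt` (p90563) and
`stub_cellAverageBound` (p91220).  Chain: `E N_ε ≤ E[2ε Σ_x t_x] = 2ε Σ_x E t_x ≤ 2ε · L⁴ · C_R(1+β^{p_R}) · C_loc`
(no measurability of the eigenvalue count is needed: `integral_mono_of_nonneg`).  When `stub_localHaarWegner` lands,
`WegnerEstimate` is `wegnerEstimate_of_localHaarWegner stub_localHaarWegner`.

Sources: Wegner, Z. Phys. B 44 (1981) 9 (site-local resolvent reduction `1_{|λ|<ε} ≤ 2ε Im (λ−iε)⁻¹`); E. Seiler,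
LNP 159 (1982) Ch. 1 (Wilson measure as tilted product Haar); the untilt is the tree's `CircleTransport.stub_circleUntilt`.
-/

noncomputable section

namespace Summit.QuantumFields.QCD.Cruxes.WegnerEstimate.ResolventCell

open MeasureTheory
open scoped Matrix BigOperators
open Literature.MathematicalPhysics.QuantumLattice Literature.MathematicalPhysics.QuantumFieldTheory
  Literature.Probability.LatticeModels
open Summit.QuantumFields.QCD.Theses.SpectralDefectExtinction (WegnerEstimate)
open Matrix

/-- `Im tr M = Σ_x Σ_a Σ_α Im M_{(x,a,α),(x,a,α)}`: the trace of the resolvent is the site sum of the local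
traces. -/
theorem reduction_trace_im_eq_sum_sites {L : ℕ} [NeZero L] (M : Matrix (QuarkIdx L) (QuarkIdx L) ℂ) :
    M.trace.im = ∑ x : TorusSite 4 L, ∑ a : Fin 3, ∑ α : Fin 4, (M (x, a, α) (x, a, α)).im := by
  rw [Matrix.trace, Complex.im_sum]
  simp only [Matrix.diag_apply, Fintype.sum_prod_type]

/-- `|TorusSite 4 L| = L⁴`. -/
theorem reduction_card_torusSite (L : ℕ) [NeZero L] : Fintype.card (TorusSite 4 L) = L ^ 4 := by
  simp [ZMod.card]

/-- **The resolvent–cell reduction (conditional form of the line's composition).**  IF for some cube radius `R`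
and constant `C` the Haar average over the links based in `x + box 4 R` (glued into an arbitrary exterior) of the
site-local trace `t_x = Σ_{a,α} Im ((Γ₅D_W(·,m₀,1) − iε)⁻¹)_{(x,a,α),(x,a,α)}` is `≤ C` uniformly in `L ≥ 2`, `x`, the
exterior, `m₀ ∈ [−1,0]` and `ε ∈ (0,1]` (the open stub `stub_localHaarWegner` of line `Sketch`, stated here verbatim as
the hypothesis), THEN the crux `WegnerEstimate` holds, with `C_crux = 2 C_R C` and `p = p_R` from
`stub_cellAverageBound R`. -/
theorem wegnerEstimate_of_localHaarWegner
    (hloc : ∃ R : ℕ, ∃ C : ℝ, 0 < C ∧ ∀ (L : ℕ) [NeZero L], 2 ≤ L →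
      ∀ (x : TorusSite 4 L) (m₀ ε : ℝ), -1 ≤ m₀ → m₀ ≤ 0 → 0 < ε → ε ≤ 1 →
      ∀ U : GaugeConfig 4 L SU3,
        ∫ V, (∑ a : Fin 3, ∑ α : Fin 4,
          (((spinorLift gammaFive * wilsonDirac (fundamentalRep (Fin 3))
              (fun e => if (∃ y ∈ box 4 R, e.1 = x + Torus.proj L y) then V e else U e) m₀ 1 -
            ((ε : ℂ) * Complex.I) • (1 : Matrix (QuarkIdx L) (QuarkIdx L) ℂ))⁻¹ :
              Matrix (QuarkIdx L) (QuarkIdx L) ℂ) (x, a, α) (x, a, α)).im)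
          ∂(Measure.pi fun _ : Edge 4 L => haarProbability SU3) ≤ C) :
    WegnerEstimate := by
  have hcount := stub_countLeResolvent
  have hreg := stub_localTraceRegular
  have hcell := stub_cellAverageBound
  obtain ⟨R, Cloc, hCloc, hloc⟩ := hloc
  obtain ⟨C₁, p, hC₁, hp, hcell⟩ := hcell R
  refine ⟨2 * C₁ * Cloc, p, by positivity, hp, ?_⟩
  intro β hβ L _ hL m₀ ε hm hm' hε hε1
  -- abbreviations
  set μW : Measure (GaugeConfig 4 L SU3) := wilsonMeasure (d := 4) (L := L) (fundamentalRep (Fin 3)) β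
    with hμW
  set t : TorusSite 4 L → GaugeConfig 4 L SU3 → ℝ := fun x U =>
    ∑ a : Fin 3, ∑ α : Fin 4,
      (((spinorLift gammaFive * wilsonDirac (fundamentalRep (Fin 3)) U m₀ 1 -
        ((ε : ℂ) * Complex.I) • (1 : Matrix (QuarkIdx L) (QuarkIdx L) ℂ))⁻¹ :
          Matrix (QuarkIdx L) (QuarkIdx L) ℂ) (x, a, α) (x, a, α)).im
    with ht
  -- pointwise: count ≤ 2ε Σ_x t_x
  have hpt : ∀ U : GaugeConfig 4 L SU3,
      (Multiset.countP (fun z : ℂ => |z.re| < ε)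
        (spinorLift gammaFive * wilsonDirac (fundamentalRep (Fin 3)) U m₀ 1).charpoly.roots : ℝ) ≤
      2 * ε * ∑ x : TorusSite 4 L, t x U := by
    intro U
    have h := hcount L U m₀ ε hε
    rw [reduction_trace_im_eq_sum_sites] at h
    exact h
  -- each local trace is integrable and its Wilson expectation is bounded
  have hint : ∀ x : TorusSite 4 L, Integrable (t x) μW := by
    intro x
    obtain ⟨hcont, hbd⟩ := hreg L x m₀ ε hε
    refine Integrable.of_bound hcont.aestronglyMeasurable (12 / ε) (Filter.Eventually.of_forall fun U => ?_)
    rw [Real.norm_eq_abs, abs_of_nonneg (hbd U).1]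
    exact (hbd U).2
  have hEt : ∀ x : TorusSite 4 L, ∫ U, t x U ∂μW ≤ C₁ * (1 + β ^ p) * Cloc := by
    intro x
    obtain ⟨hcont, hbd⟩ := hreg L x m₀ ε hε
    exact hcell β hβ L hL x (t x) hcont (fun U => (hbd U).1) Cloc
      (fun U => hloc L hL x m₀ ε hm hm' hε hε1 U)
  -- integrate the pointwise bound
  have hsumInt : Integrable (fun U => 2 * ε * ∑ x : TorusSite 4 L, t x U) μW :=
    (integrable_finsetSum _ fun x _ => hint x).const_mul (2 * ε)
  have hL4 : (0 : ℝ) ≤ (L : ℝ) ^ 4 := by positivity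
  calc ∫ U, (Multiset.countP (fun z : ℂ => |z.re| < ε)
          (spinorLift gammaFive * wilsonDirac (fundamentalRep (Fin 3)) U m₀ 1).charpoly.roots : ℝ) ∂μW
      ≤ ∫ U, 2 * ε * ∑ x : TorusSite 4 L, t x U ∂μW :=
        integral_mono_of_nonneg (Filter.Eventually.of_forall fun U => Nat.cast_nonneg _) hsumInt
          (Filter.Eventually.of_forall hpt)
    _ = 2 * ε * ∑ x : TorusSite 4 L, ∫ U, t x U ∂μW := by
        rw [integral_const_mul, integral_finsetSum _ fun x _ => hint x]
    _ ≤ 2 * ε * ∑ _x : TorusSite 4 L, C₁ * (1 + β ^ p) * Cloc := by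
        gcongr with x _
        exact hEt x
    _ = 2 * C₁ * Cloc * (1 + β ^ p) * ε * (L : ℝ) ^ 4 := by
        rw [Finset.sum_const, Finset.card_univ, reduction_card_torusSite, nsmul_eq_mul]
        push_cast
        ring

end Summit.QuantumFields.QCD.Cruxes.WegnerEstimate.ResolventCell

end
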